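import Literature.MathematicalPhysics.QuantumLattice.HyperoctahedralTransposition
import Literature.MathematicalPhysics.QuantumLattice.HubbardAtomicLimit
import Literature.MathematicalPhysics.QuantumLattice.NagaokaTasaki
import Literature.MathematicalPhysics.QuantumLattice.HubbardWave0LiebProofs
import HarnessLib

/-!
# CAR bookkeeping and doublon absorption for the supersymmetric `t`-`J` bond identity

Topic `Literature/MathematicalPhysics/QuantumLattice` (sub-namespace `SusyTJ`). Written for route
`HubbardSuperconductivity/HyperoctahedralMott`, support `SusyInterchangeIdentity`
(stmt-HubbardSuperconductivity-6675); consumed by `SusyTJBondIdentity.lean`.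

Elementary consequences of the canonical anticommutation relations in the tree's Jordan–Wigner
model (`HubbardWave0.creation` / `annihilation` on `Fock ι = Finset ι → ℂ`), used by the
bond-local proof of the supersymmetric interchange identity
(`HyperoctahedralMottSusyInterchangeIdentity.lean`):

* `susy_free_identity` — the identity behind the `J = 2t` supersymmetric point as a FREE
  noncommutative polynomial identity in eight letters (hopping + normal-ordered singlet-pair
  density = graded swap + `n^s_x + n^s_y - 1` + an explicit twelve-monomial remainder);
* anticommutation of two DISTINCT ladder operators in all four flavours (`ladder_anticomm`) and the
  resulting commutation of a ladder operator with an even bilinear in other orbitals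
  (`ladder_mul_bilinear_comm`);
* number-operator rules `c_i n_i = c_i`, `n_i n_i = n_i`, `n_i n_j = n_j n_i`, `n_i c_j = c_j n_i`;
* the five DOUBLON ABSORPTION shapes `(n_i n_j) · S = S` / `S · (n_i n_j) = S` (`doublon_absorb₁…₅`)
  for the monomials of the remainder, and the sandwich-kill lemmas (`sandwich_eq_zero_of_left/right`).

Pure algebra over the tree's `annihilation_anticommute_holds`, `LiebThm1.annihilation_mul_self`,
`annihilation_mul_creation_add_creation_mul_annihilation_holds`, `creation_anticomm`,
`annihilation_mul_creation`, `numberAt_idempotent`, `numberAt_commute`; no definitions.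
Source for the CAR: Bratteli–Robinson, *Operator Algebras and QSM II* §5.2.2; for the physics
context S. Sarkar, J. Phys. A 24 (1991) 1137.
-/

namespace Literature.MathematicalPhysics.QuantumLattice.SusyTJ

open Matrix Finset Literature.MathematicalPhysics.QuantumLattice HubbardWave0

section Ring

variable {R : Type*} [Ring R]

/-- If `u` anticommutes with `z` and `w`, then `u` commutes with `z w`. [folklore] -/
theorem mul_comm_of_anticomm {u z w : R} (huz : u * z + z * u = 0) (huw : u * w + w * u = 0) :
    u * (z * w) = z * w * u := by
  rw [← sub_eq_zero]
  have key : u * (z * w) - z * w * u = (u * z + z * u) * w - z * (u * w + w * u) := by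
    noncomm_ring
  rw [key, huz, huw]
  noncomm_ring

/-- The supersymmetric interchange identity as a FREE noncommutative polynomial identity in eight
letters (`A_σ = c†_{xσ}`, `a_σ = c_{xσ}`, `B_σ = c†_{yσ}`, `b_σ = c_{yσ}`): hopping plus the
normal-ordered singlet-pair density equals graded swap plus `n^s_x + n^s_y - 1` plus an explicit
remainder of twelve monomials (each containing, or absorbed by, a doublon). [folklore] -/
theorem susy_free_identity (A0 A1 B0 B1 a0 a1 b0 b1 : R) :
    A0 * b0 + B0 * a0 + (A1 * b1 + B1 * a1) +
        (A0 * a0 * (B1 * b1) + B0 * b0 * (A1 * a1) + A0 * b0 * (B1 * a1) + B0 * a0 * (A1 * b1)) =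
      (1 - (A0 - B0) * (a0 - b0)) * (1 - (A1 - B1) * (a1 - b1)) +
          (A0 * a0 + A1 * a1 - (A0 * a0 * (A1 * a1) + A0 * a0 * (A1 * a1))) +
          (B0 * b0 + B1 * b1 - (B0 * b0 * (B1 * b1) + B0 * b0 * (B1 * b1))) - 1 +
        (A0 * a0 * (A1 * a1) + B0 * b0 * (B1 * b1) +
          (A0 * a0 + B0 * b0) * (A1 * b1 + B1 * a1) + (A0 * b0 + B0 * a0) * (A1 * a1 + B1 * b1) -
          A0 * b0 * (A1 * b1) - B0 * a0 * (B1 * a1)) := by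
  noncomm_ring

end Ring

section Ladder

variable {ι : Type*} [LinearOrder ι] [Fintype ι]

/-- Two ladder operators (`c` or `c†`) of DISTINCT orbitals anticommute, in all four flavours.
[folklore] -/
theorem ladder_anticomm {i j : ι} (hij : i ≠ j) {X Y : Matrix (Finset ι) (Finset ι) ℂ}
    (hX : X = creation i ∨ X = annihilation i) (hY : Y = creation j ∨ Y = annihilation j) :
    X * Y + Y * X = 0 := by
  rcases hX with rfl | rfl <;> rcases hY with rfl | rfl
  · exact creation_anticomm i j
  · have h := annihilation_mul_creation_add_creation_mul_annihilation_holds (ι := ι) j i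
    rw [if_neg hij.symm] at h
    rwa [add_comm] at h
  · have h := annihilation_mul_creation_add_creation_mul_annihilation_holds (ι := ι) i j
    rwa [if_neg hij] at h
  · exact annihilation_anticommute_holds i j

/-- A ladder operator of orbital `p` commutes with a bilinear in two other orbitals `r, s`.
[folklore] -/
theorem ladder_mul_bilinear_comm {p r s : ι} {X Z W : Matrix (Finset ι) (Finset ι) ℂ}
    (hX : X = creation p ∨ X = annihilation p) (hZ : Z = creation r ∨ Z = annihilation r)
    (hW : W = creation s ∨ W = annihilation s) (hpr : p ≠ r) (hps : p ≠ s) :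
    X * (Z * W) = Z * W * X :=
  mul_comm_of_anticomm (ladder_anticomm hpr hX hZ) (ladder_anticomm hps hX hW)

/-- `c_i c†_j = -c†_j c_i` for `i ≠ j`. [folklore] -/
theorem annihilation_mul_creation_of_ne {i j : ι} (hij : i ≠ j) :
    annihilation i * creation j = -(creation j * annihilation i) := by
  rw [annihilation_mul_creation, if_neg hij, zero_sub]

/-- `c†_j c_i = -c_i c†_j` for `i ≠ j`. [folklore] -/
theorem creation_mul_annihilation_of_ne {i j : ι} (hij : i ≠ j) :
    creation j * annihilation i = -(annihilation i * creation j) := by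
  rw [annihilation_mul_creation_of_ne hij, neg_neg]

/-- `c_i n_i = c_i` (annihilating requires the orbital to be occupied). [folklore] -/
theorem annihilation_mul_number_self (i : ι) :
    annihilation i * (creation i * annihilation i) = annihilation i := by
  rw [← mul_assoc, annihilation_mul_creation, if_pos rfl, sub_mul, one_mul, mul_assoc,
    LiebThm1.annihilation_mul_self, mul_zero, sub_zero]

/-- `n_i n_i = n_i`. [folklore] -/
theorem number_mul_number_self (i : ι) :
    creation i * annihilation i * (creation i * annihilation i) = creation i * annihilation i :=
  numberAt_idempotent i

/-- `n_i n_j = n_j n_i`. [folklore] -/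
theorem number_mul_number_comm (i j : ι) :
    creation i * annihilation i * (creation j * annihilation j) =
      creation j * annihilation j * (creation i * annihilation i) :=
  numberAt_commute i j

/-- `n_a c_p = c_p n_a` for `a ≠ p`. [folklore] -/
theorem number_mul_annihilation_of_ne {a p : ι} (h : a ≠ p) :
    creation a * annihilation a * annihilation p = annihilation p * (creation a * annihilation a) :=
  (ladder_mul_bilinear_comm (Or.inr rfl) (Or.inl rfl) (Or.inr rfl) h.symm h.symm).symm

end Ladder

section Absorb

variable {ι : Type*} [LinearOrder ι] [Fintype ι]

/-- Doublon absorption, shape 1: `(n_i n_j) · n_i c†_j Z = n_i c†_j Z`. [folklore] -/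
theorem doublon_absorb₁ (i j : ι) (Z : Matrix (Finset ι) (Finset ι) ℂ) :
    creation i * annihilation i * (creation j * annihilation j) *
        (creation i * annihilation i * (creation j * Z)) =
      creation i * annihilation i * (creation j * Z) := by
  have h1 := number_mul_number_comm i j
  have h2 := number_mul_number_self i
  have h3 := number_mul_creation_self j
  calc creation i * annihilation i * (creation j * annihilation j) *
        (creation i * annihilation i * (creation j * Z))
      = creation j * annihilation j * (creation i * annihilation i) *
        (creation i * annihilation i) * creation j * Z := by rw [h1]; noncomm_ring
    _ = creation j * annihilation j *
        (creation i * annihilation i * (creation i * annihilation i)) * creation j * Z := by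
          noncomm_ring
    _ = creation i * annihilation i * (creation j * annihilation j * creation j) * Z := by
          rw [h2, ← h1]; noncomm_ring
    _ = _ := by rw [h3]; noncomm_ring

/-- Doublon absorption, shape 2: `n_i Z c_j · (n_i n_j) = n_i Z c_j` for a ladder operator `Z` of
an orbital `r ≠ i`. [folklore] -/
theorem doublon_absorb₂ {i j r : ι} (hij : i ≠ j) (hri : r ≠ i) {Z : Matrix (Finset ι) (Finset ι) ℂ}
    (hZ : Z = creation r ∨ Z = annihilation r) :
    creation i * annihilation i * (Z * annihilation j) *
        (creation i * annihilation i * (creation j * annihilation j)) =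
      creation i * annihilation i * (Z * annihilation j) := by
  -- `Z` and `c_j` commute with `n_i`
  have hZn : Z * (creation i * annihilation i) = creation i * annihilation i * Z :=
    ladder_mul_bilinear_comm hZ (Or.inl rfl) (Or.inr rfl) hri hri
  have hcn : annihilation j * (creation i * annihilation i) =
      creation i * annihilation i * annihilation j :=
    (number_mul_annihilation_of_ne hij).symm
  have h2 := number_mul_number_self i
  have h4 := annihilation_mul_number_self j
  calc creation i * annihilation i * (Z * annihilation j) *
        (creation i * annihilation i * (creation j * annihilation j))
      = creation i * annihilation i * Z * (annihilation j * (creation i * annihilation i)) *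
          (creation j * annihilation j) := by noncomm_ring
    _ = creation i * annihilation i * (Z * (creation i * annihilation i)) *
          (annihilation j * (creation j * annihilation j)) := by rw [hcn]; noncomm_ring
    _ = _ := by rw [hZn, h4, ← mul_assoc, h2, mul_assoc]

/-- Doublon absorption, shape 3: `(n_i n_j) · c†_i Z n_j = c†_i Z n_j` for a ladder operator `Z` of
an orbital `r ≠ j`. [folklore] -/
theorem doublon_absorb₃ {i j r : ι} (hij : i ≠ j) (hrj : r ≠ j) {Z : Matrix (Finset ι) (Finset ι) ℂ}
    (hZ : Z = creation r ∨ Z = annihilation r) :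
    creation i * annihilation i * (creation j * annihilation j) *
        (creation i * Z * (creation j * annihilation j)) =
      creation i * Z * (creation j * annihilation j) := by
  have hZn : Z * (creation j * annihilation j) = creation j * annihilation j * Z :=
    ladder_mul_bilinear_comm hZ (Or.inl rfl) (Or.inr rfl) hrj hrj
  have hcn : creation j * annihilation j * creation i = creation i * (creation j * annihilation j) :=
    number_mul_creation_of_ne hij.symm
  have h2 := number_mul_number_self j
  have h3 := number_mul_creation_self i
  calc creation i * annihilation i * (creation j * annihilation j) *
        (creation i * Z * (creation j * annihilation j))
      = creation i * annihilation i * (creation j * annihilation j * creation i) *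
          (Z * (creation j * annihilation j)) := by simp only [mul_assoc]
    _ = creation i * annihilation i * (creation i * (creation j * annihilation j)) *
          (creation j * annihilation j * Z) := by rw [hcn, hZn]
    _ = (creation i * annihilation i * creation i) *
          ((creation j * annihilation j) * (creation j * annihilation j)) * Z := by
          simp only [mul_assoc]
    _ = creation i * (creation j * annihilation j * Z) := by rw [h3, h2, mul_assoc]
    _ = _ := by rw [← hZn, mul_assoc]

/-- Doublon absorption, shape 4: `Z c_i n_j · (n_i n_j) = Z c_i n_j`. [folklore] -/
theorem doublon_absorb₄ (i j : ι) (Z : Matrix (Finset ι) (Finset ι) ℂ) :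
    Z * annihilation i * (creation j * annihilation j) *
        (creation i * annihilation i * (creation j * annihilation j)) =
      Z * annihilation i * (creation j * annihilation j) := by
  have h1 := number_mul_number_comm i j
  have h2 := number_mul_number_self j
  have h4 := annihilation_mul_number_self i
  calc Z * annihilation i * (creation j * annihilation j) *
        (creation i * annihilation i * (creation j * annihilation j))
      = Z * annihilation i * (creation j * annihilation j * (creation i * annihilation i)) *
          (creation j * annihilation j) := by noncomm_ring
    _ = Z * (annihilation i * (creation i * annihilation i)) *
          (creation j * annihilation j * (creation j * annihilation j)) := by rw [← h1]; noncomm_ring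
    _ = _ := by rw [h4, h2, mul_assoc]

/-- Doublon absorption, shape 5: `(n_i n_j) · c†_i c†_j W = c†_i c†_j W`. [folklore] -/
theorem doublon_absorb₅ {i j : ι} (hij : i ≠ j) (W : Matrix (Finset ι) (Finset ι) ℂ) :
    creation i * annihilation i * (creation j * annihilation j) * (creation i * creation j * W) =
      creation i * creation j * W := by
  have hcn : creation j * annihilation j * creation i = creation i * (creation j * annihilation j) :=
    number_mul_creation_of_ne hij.symm
  have h3 := number_mul_creation_self i
  have h3' := number_mul_creation_self j
  calc creation i * annihilation i * (creation j * annihilation j) * (creation i * creation j * W)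
      = creation i * annihilation i * (creation j * annihilation j * creation i) * creation j * W := by
          noncomm_ring
    _ = (creation i * annihilation i * creation i) * (creation j * annihilation j * creation j) * W := by
          rw [hcn]; noncomm_ring
    _ = _ := by rw [h3, h3']

/-- Sandwich kill, left: if `P D = 0` and `D S = S` then `P S P = 0`. [folklore] -/
theorem sandwich_eq_zero_of_left {P D S : Matrix (Finset ι) (Finset ι) ℂ} (hPD : P * D = 0)
    (h : D * S = S) : P * S * P = 0 := by
  rw [← h, ← mul_assoc, hPD, zero_mul, zero_mul]

/-- Sandwich kill, right: if `D P = 0` and `S D = S` then `P S P = 0`. [folklore] -/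
theorem sandwich_eq_zero_of_right {P D S : Matrix (Finset ι) (Finset ι) ℂ} (hDP : D * P = 0)
    (h : S * D = S) : P * S * P = 0 := by
  rw [← h, mul_assoc, mul_assoc, hDP, mul_zero, mul_zero]

end Absorb

end Literature.MathematicalPhysics.QuantumLattice.SusyTJ
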